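import Summits.ValiantsHypothesis.ValiantsHypothesis.Theorems.DivisionGapZeroOneTransferStubPickParityAux1
import HarnessLib

/-!
# Winding numbers of closed walks on the triangular lattice, II: simple walks, Pick's theorem in winding form

Second proof file for the registered stub `stub_pickParity` of line `charged-uncharged` of crux
`ZeroOneTransfer` (stmt-ValiantsHypothesis-5066, route DivisionGap); sequel to
`Theorems/DivisionGapZeroOneTransferStubPickParityAux1.lean`, vocabulary in
`Theorems/DivisionGapZeroOneTransferTriWalkDefs.lean`.  Triangular analogue of the second half of
`Literature/Probability/LatticeModels/LatticeLoopWinding.lean`: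

* on a SIMPLE walk (every vertex passed once per period) the traversal counts at a vertex are
  indicators (`cnt_out`, `cnt_in`), and the angle-weighted face sum of the six triangles around the
  vertex `v (j+1)` is `8 R + 4 - turn`, `R` the winding number of the triangle to the right of the
  outgoing step, `turn ∈ {0, ±1, ±2, ±3}` the exterior angle in units of `45°`; the right winding
  number `R` is constant along the walk (`faceSum_vertex_and_Wrf`, `Wrf_eq` — a `36`-case check);
* **double counting** (`sum_faceSum_eq`): over the lattice points of a box containing the walk the
  face sums add up to `4 · shoelace` (the angles of a triangle make `4` units, and the winding
  numbers of all triangles sum to the shoelace sum);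
* **Pick's theorem in winding form** (`eight_mul_sum_W_notMem`, registered sub-goal
  `pickParity_eight_mul_sum_W_notMem`): `8 Σ_{u ∉ walk} W₁ u = 4 · shoelace - ℓ (8R + 4) + Σ turn`.
[cite: Kenyon2009, §3.3] [cite: Kasteleyn1961]
-/

namespace Summit.ValiantsHypothesis.ValiantsHypothesis.Theorems.DivisionGapZeroOneTransfer

-- the single-problem summit's namespace `Summit.ValiantsHypothesis.ValiantsHypothesis` repeats
set_option linter.dupNamespace false

open Finset Literature.Probability.LatticeModels

namespace TriWalk

variable {ℓ : ℕ} (c : TriWalk ℓ)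

/-! ### Simple walks: the faces around a vertex

Throughout, `hs : ∀ i j, c.v i = c.v j → i % ℓ = j % ℓ` says that the walk is SIMPLE (it passes
through every vertex once per period). -/

/-- On a simple walk the edge out of `v i` towards `Q` is traversed iff `Q = v (i + 1)`.
[folklore] -/
theorem cnt_out (hs : ∀ i j, c.v i = c.v j → i % ℓ = j % ℓ) (hn : 0 < ℓ) (i : ℕ) (Q : ℤ × ℤ) :
    c.cnt (c.v i) Q = indZ (c.v (i + 1) = Q) := by
  unfold cnt
  rw [sum_eq_single (i % ℓ)]
  · have h1 : c.v (i % ℓ + 1) = c.v (i + 1) :=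
      c.v_eq_of_mod_eq (by rw [Nat.add_mod, Nat.mod_mod, ← Nat.add_mod])
    rw [c.v_mod, h1]
    simp [indZ_apply]
  · intro b hb hbi
    refine indZ_of_neg fun h => hbi ?_
    have := hs _ _ h.1
    rwa [Nat.mod_eq_of_lt (mem_range.1 hb)] at this
  · exact fun h => absurd (mem_range.2 (Nat.mod_lt _ hn)) h

/-- On a simple walk the edge into `v (i + 1)` from `P` is traversed iff `P = v i`. [folklore] -/
theorem cnt_in (hs : ∀ i j, c.v i = c.v j → i % ℓ = j % ℓ) (hn : 0 < ℓ) (i : ℕ) (P : ℤ × ℤ) :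
    c.cnt P (c.v (i + 1)) = indZ (c.v i = P) := by
  unfold cnt
  rw [sum_eq_single (i % ℓ)]
  · have h1 : c.v (i % ℓ + 1) = c.v (i + 1) :=
      c.v_eq_of_mod_eq (by rw [Nat.add_mod, Nat.mod_mod, ← Nat.add_mod])
    rw [c.v_mod, h1]
    simp [indZ_apply]
  · intro b hb hbi
    refine indZ_of_neg fun h => hbi ?_
    have h2 := hs _ _ h.2
    have h3 : b % ℓ = i % ℓ :=
      Nat.ModEq.add_right_cancel' 1 (show b + 1 ≡ i + 1 [MOD ℓ] from h2)
    rwa [Nat.mod_eq_of_lt (mem_range.1 hb)] at h3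
  · exact fun h => absurd (mem_range.2 (Nat.mod_lt _ hn)) h

/-- On a simple walk of period at least `3`, the vertices before and after a vertex differ.
[folklore] -/
theorem v_ne_v_add_two (hs : ∀ i j, c.v i = c.v j → i % ℓ = j % ℓ) (hn : 3 ≤ ℓ) (j : ℕ) : c.v j ≠ c.v (j + 2) := by
  intro h
  have h1 := hs _ _ h
  have h2 : (j + 2) % ℓ = (j % ℓ + 2) % ℓ := by
    rw [Nat.add_mod, Nat.mod_eq_of_lt (show 2 < ℓ by omega)]
  rw [h2] at h1
  have h3 : j % ℓ < ℓ := Nat.mod_lt _ (by omega)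
  by_cases h4 : j % ℓ + 2 < ℓ
  · rw [Nat.mod_eq_of_lt h4] at h1; omega
  · have h5 : (j % ℓ + 2) % ℓ = j % ℓ + 2 - ℓ := by
      rw [Nat.mod_eq_sub_mod (by omega), Nat.mod_eq_of_lt (by omega)]
    rw [h5] at h1; omega

/-- The previous vertex as `v (j + 1) + p` for one of the six unit steps `p`. [folklore] -/
theorem prev_eq (j : ℕ) :
    c.v j = c.v (j + 1) + (-1, 0) ∨ c.v j = c.v (j + 1) + (1, 0) ∨ c.v j = c.v (j + 1) + (0, -1) ∨
      c.v j = c.v (j + 1) + (0, 1) ∨ c.v j = c.v (j + 1) + (-1, 1) ∨ c.v j = c.v (j + 1) + (1, -1) := by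
  rcases c.step_coord j with h | h | h | h | h | h <;>
    simp only [Prod.ext_iff, Prod.fst_add, Prod.snd_add] <;> omega

/-- The next vertex as `v j + q` for one of the six unit steps `q`. [folklore] -/
theorem next_eq (j : ℕ) :
    c.v (j + 1) = c.v j + (1, 0) ∨ c.v (j + 1) = c.v j + (-1, 0) ∨ c.v (j + 1) = c.v j + (0, 1) ∨
      c.v (j + 1) = c.v j + (0, -1) ∨ c.v (j + 1) = c.v j + (1, -1) ∨ c.v (j + 1) = c.v j + (-1, 1) := by
  rcases c.step_coord j with h | h | h | h | h | h <;>
    simp only [Prod.ext_iff, Prod.fst_add, Prod.snd_add] <;> omega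

/-- **The triangles around a vertex of a simple walk.** At `u = v (j + 1)` (entered from `v j`,
left towards `v (j + 2)`): the angle-weighted face sum is `8 R + 4 - turn`, `R` the winding
number of the triangle to the right of the outgoing step and `turn ∈ {0, ±1, ±2, ±3}` the exterior
angle at `u` in units of `45°`; and the triangles to the right of the incoming and of the outgoing
step have the same winding number. (Going once around `u`, the winding number jumps by `+1`
across the outgoing edge and by `-1` across the incoming one, and nowhere else; the left side of
the walk at `u` spans `4 - turn` units of `45°`, the right side `4 + turn`.) [folklore] -/
theorem faceSum_vertex_and_Wrf (hs : ∀ i j, c.v i = c.v j → i % ℓ = j % ℓ) (hn : 3 ≤ ℓ) (j : ℕ) :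
    c.faceSum (c.v (j + 1)) = 8 * c.Wrf (c.v (j + 1)) (c.v (j + 2)) + 4 -
        turn (c.v (j + 1) - c.v j) (c.v (j + 2) - c.v (j + 1)) ∧
      c.Wrf (c.v j) (c.v (j + 1)) = c.Wrf (c.v (j + 1)) (c.v (j + 2)) := by
  have hn0 : 0 < ℓ := by omega
  have hPQ := c.v_ne_v_add_two hs hn j
  -- the six edge equations around `u = v (j+1) = (a, b)`
  have e1 := c.W₁_sub_W₂_left (c.v (j + 1)).1 (c.v (j + 1)).2
  have e2 := c.W₁_sub_W₂_below (c.v (j + 1)).1 (c.v (j + 1)).2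
  have e3 := c.W₁_sub_W₂_diag ((c.v (j + 1)).1 - 1) (c.v (j + 1)).2
  have e4 := c.W₁_sub_W₂_diag (c.v (j + 1)).1 ((c.v (j + 1)).2 - 1)
  have e5 := c.W₁_sub_W₂_below ((c.v (j + 1)).1 - 1) (c.v (j + 1)).2
  have e6 := c.W₁_sub_W₂_left (c.v (j + 1)).1 ((c.v (j + 1)).2 - 1)
  rw [sub_add_cancel] at e3 e4 e5 e6
  rw [Prod.mk.eta, c.cnt_out hs hn0, c.cnt_in hs hn0] at e1 e2
  rw [Prod.mk.eta, c.cnt_out hs hn0 (j + 1), c.cnt_in hs hn0 j] at e3 e4 e5 e6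
  have hp := c.prev_eq j
  have hq := c.next_eq (j + 1)
  unfold faceSum
  generalize c.v j = P at hPQ e1 e2 e3 e4 e5 e6 hp ⊢
  generalize c.v (j + 1 + 1) = Q at hPQ e1 e2 e3 e4 e5 e6 hq ⊢
  generalize c.v (j + 1) = u at hPQ e1 e2 e3 e4 e5 e6 hp hq ⊢
  obtain ⟨a, b⟩ := u
  rcases hp with rfl | rfl | rfl | rfl | rfl | rfl <;>
  rcases hq with rfl | rfl | rfl | rfl | rfl | rfl <;>
    simp [Wrf, turn, indZ_apply, Prod.ext_iff, ← sub_eq_add_neg, add_sub_cancel_right]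
      at hPQ e1 e2 e3 e4 e5 e6 ⊢ <;> omega

/-- The angle-weighted face sum at a vertex of a simple walk (first half of
`faceSum_vertex_and_Wrf`). [folklore] -/
theorem faceSum_vertex (hs : ∀ i j, c.v i = c.v j → i % ℓ = j % ℓ) (hn : 3 ≤ ℓ) (j : ℕ) :
    c.faceSum (c.v (j + 1)) = 8 * c.Wrf (c.v (j + 1)) (c.v (j + 2)) + 4 -
      turn (c.v (j + 1) - c.v j) (c.v (j + 2) - c.v (j + 1)) :=
  (c.faceSum_vertex_and_Wrf hs hn j).1

/-- **The right winding number is constant along a simple walk.** [folklore] -/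
theorem Wrf_eq (hs : ∀ i j, c.v i = c.v j → i % ℓ = j % ℓ) (hn : 3 ≤ ℓ) (j : ℕ) :
    c.Wrf (c.v j) (c.v (j + 1)) = c.Wrf (c.v 0) (c.v 1) := by
  induction j with
  | zero => rfl
  | succ j ih => rw [← ih, (c.faceSum_vertex_and_Wrf hs hn j).2]

/-! ### Double counting of the angle-weighted face sums -/

/-- A shifted sum of `W₁` over a box of lattice points containing the faces spanned by the walk
is the sum of `W₁` over those faces. [folklore] -/
theorem sum_W₁_shift {P₀ P₁ Q₀ Q₁ : ℤ} (hX : ∀ j, P₀ ≤ (c.v j).1 ∧ (c.v j).1 ≤ P₁)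
    (hY : ∀ j, Q₀ ≤ (c.v j).2 ∧ (c.v j).2 ≤ Q₁) (s t : ℤ) (hs : s = 0 ∨ s = 1) (ht : t = 0 ∨ t = 1) :
    ∑ u ∈ Icc P₀ P₁ ×ˢ Icc Q₀ Q₁, c.W₁ (u.1 - s) (u.2 - t) =
      ∑ f ∈ Ico P₀ P₁ ×ˢ Ico Q₀ Q₁, c.W₁ f.1 f.2 := by
  have hg : Function.Injective fun u : ℤ × ℤ => (u.1 - s, u.2 - t) := fun u u' h => by
    simp only [Prod.mk.injEq] at h; exact Prod.ext (by omega) (by omega)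
  have h1 : ∑ u ∈ Icc P₀ P₁ ×ˢ Icc Q₀ Q₁, c.W₁ (u.1 - s) (u.2 - t) =
      ∑ f ∈ (Icc P₀ P₁ ×ˢ Icc Q₀ Q₁).image (fun u : ℤ × ℤ => (u.1 - s, u.2 - t)), c.W₁ f.1 f.2 := by
    rw [sum_image fun x _ y _ h => hg h]
  rw [h1]
  symm
  refine sum_subset (fun f hf => ?_) fun f _ hf => c.W₁_eq_zero_of_notMem_box hX hY hf
  simp only [mem_image, mem_product, mem_Icc, mem_Ico] at hf ⊢
  exact ⟨(f.1 + s, f.2 + t), by omega, by simp⟩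

/-- A shifted sum of `W₂` over a box of lattice points containing the faces spanned by the walk
is the sum of `W₂` over those faces. [folklore] -/
theorem sum_W₂_shift {P₀ P₁ Q₀ Q₁ : ℤ} (hX : ∀ j, P₀ ≤ (c.v j).1 ∧ (c.v j).1 ≤ P₁)
    (hY : ∀ j, Q₀ ≤ (c.v j).2 ∧ (c.v j).2 ≤ Q₁) (s t : ℤ) (hs : s = 0 ∨ s = 1) (ht : t = 0 ∨ t = 1) :
    ∑ u ∈ Icc P₀ P₁ ×ˢ Icc Q₀ Q₁, c.W₂ (u.1 - s) (u.2 - t) =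
      ∑ f ∈ Ico P₀ P₁ ×ˢ Ico Q₀ Q₁, c.W₂ f.1 f.2 := by
  have hg : Function.Injective fun u : ℤ × ℤ => (u.1 - s, u.2 - t) := fun u u' h => by
    simp only [Prod.mk.injEq] at h; exact Prod.ext (by omega) (by omega)
  have h1 : ∑ u ∈ Icc P₀ P₁ ×ˢ Icc Q₀ Q₁, c.W₂ (u.1 - s) (u.2 - t) =
      ∑ f ∈ (Icc P₀ P₁ ×ˢ Icc Q₀ Q₁).image (fun u : ℤ × ℤ => (u.1 - s, u.2 - t)), c.W₂ f.1 f.2 := by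
    rw [sum_image fun x _ y _ h => hg h]
  rw [h1]
  symm
  refine sum_subset (fun f hf => ?_) fun f _ hf => c.W₂_eq_zero_of_notMem_box hX hY hf
  simp only [mem_image, mem_product, mem_Icc, mem_Ico] at hf ⊢
  exact ⟨(f.1 + s, f.2 + t), by omega, by simp⟩

/-- **Double counting**: summing the angle-weighted face sums over the lattice points of a box
containing the walk gives four times the shoelace sum (the three angles of a triangle make `4`
units of `45°`, and the winding numbers of all triangles sum to the shoelace sum). [folklore] -/
theorem sum_faceSum_eq {P₀ P₁ Q₀ Q₁ : ℤ} (hX : ∀ j, P₀ ≤ (c.v j).1 ∧ (c.v j).1 ≤ P₁)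
    (hY : ∀ j, Q₀ ≤ (c.v j).2 ∧ (c.v j).2 ≤ Q₁) :
    ∑ u ∈ Icc P₀ P₁ ×ˢ Icc Q₀ Q₁, c.faceSum u = 4 * c.shoelace := by
  unfold faceSum
  simp only [sum_add_distrib, ← mul_sum]
  have a00 := c.sum_W₁_shift hX hY 0 0 (Or.inl rfl) (Or.inl rfl)
  have a10 := c.sum_W₁_shift hX hY 1 0 (Or.inr rfl) (Or.inl rfl)
  have a01 := c.sum_W₁_shift hX hY 0 1 (Or.inl rfl) (Or.inr rfl)
  have b11 := c.sum_W₂_shift hX hY 1 1 (Or.inr rfl) (Or.inr rfl)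
  have b10 := c.sum_W₂_shift hX hY 1 0 (Or.inr rfl) (Or.inl rfl)
  have b01 := c.sum_W₂_shift hX hY 0 1 (Or.inl rfl) (Or.inr rfl)
  simp only [sub_zero] at a00 a10 a01 b10 b01
  rw [a00, a10, a01, b11, b10, b01]
  have := c.sum_W_box_eq_shoelace hX hY
  rw [sum_add_distrib] at this
  linarith

/-! ### Pick's theorem mod 4, winding form -/

/-- **The winding numbers of the lattice points off a simple walk, summed** (eight times):
`8 ∑_{u ∉ walk} W₁ u = 4·shoelace - ℓ (8R + 4) + Σ turn`, the sum over the lattice points of any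
box containing the walk, `R` the (constant) right winding number. [folklore] -/
theorem eight_mul_sum_W_notMem (hs : ∀ i j, c.v i = c.v j → i % ℓ = j % ℓ) (hn : 3 ≤ ℓ) {P₀ P₁ Q₀ Q₁ : ℤ}
    (hX : ∀ j, P₀ ≤ (c.v j).1 ∧ (c.v j).1 ≤ P₁) (hY : ∀ j, Q₀ ≤ (c.v j).2 ∧ (c.v j).2 ≤ Q₁) :
    8 * ∑ u ∈ (Icc P₀ P₁ ×ˢ Icc Q₀ Q₁).filter (fun u => u ∉ (range ℓ).image c.v), c.W₁ u.1 u.2 =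
      4 * c.shoelace - ℓ * (8 * c.Wrf (c.v 0) (c.v 1) + 4) +
        ∑ j ∈ range ℓ, turn (c.v (j + 1) - c.v j) (c.v (j + 2) - c.v (j + 1)) := by
  have hn0 : 0 < ℓ := by omega
  have hmem : ∀ {u : ℤ × ℤ}, u ∈ (range ℓ).image c.v ↔ ∃ j, c.v j = u := fun {u} => by
    simp only [mem_image, mem_range]
    exact ⟨fun ⟨j, _, hj⟩ => ⟨j, hj⟩, fun ⟨j, hj⟩ => ⟨j % ℓ, Nat.mod_lt _ hn0, by rw [c.v_mod, hj]⟩⟩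
  set B := Icc P₀ P₁ ×ˢ Icc Q₀ Q₁ with hB
  have htot := c.sum_faceSum_eq hX hY
  rw [← sum_filter_add_sum_filter_not B (fun u => u ∈ (range ℓ).image c.v)] at htot
  -- the lattice points off the walk
  have h1 : ∑ u ∈ B.filter (fun u => u ∉ (range ℓ).image c.v), c.faceSum u =
      8 * ∑ u ∈ B.filter (fun u => u ∉ (range ℓ).image c.v), c.W₁ u.1 u.2 := by
    rw [mul_sum]
    refine sum_congr rfl fun u hu => c.faceSum_eq_of_notMem fun j hj => ?_
    exact (mem_filter.1 hu).2 (hmem.2 ⟨j, hj⟩)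
  -- the vertices of the walk
  have hsub : (range ℓ).image c.v ⊆ B := by
    intro u hu
    obtain ⟨j, rfl⟩ := hmem.1 hu
    simp only [hB, mem_product, mem_Icc]
    exact ⟨hX j, hY j⟩
  have h2 : ∑ u ∈ B.filter (fun u => u ∈ (range ℓ).image c.v), c.faceSum u =
      ℓ * (8 * c.Wrf (c.v 0) (c.v 1) + 4) -
        ∑ j ∈ range ℓ, turn (c.v (j + 1) - c.v j) (c.v (j + 2) - c.v (j + 1)) := by
    rw [filter_mem_eq_inter, inter_eq_right.2 hsub]
    rw [sum_image fun i hi j hj h => by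
      have := hs i j h
      rwa [Nat.mod_eq_of_lt (mem_range.1 hi), Nat.mod_eq_of_lt (mem_range.1 hj)] at this]
    rw [← sum_range_succ_of_periodic (g := fun j => c.faceSum (c.v j)) (by simp only [c.v_ℓ])]
    have e3 : ∀ j ∈ range ℓ, c.faceSum (c.v (j + 1)) = (8 * c.Wrf (c.v 0) (c.v 1) + 4) -
        turn (c.v (j + 1) - c.v j) (c.v (j + 2) - c.v (j + 1)) := fun j _ => by
      rw [c.faceSum_vertex hs hn, c.Wrf_eq hs hn]
    rw [sum_congr rfl e3, sum_sub_distrib, sum_const, card_range, nsmul_eq_mul]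
  rw [h1, h2] at htot
  linarith

end TriWalk

/-- **Pick's theorem in winding form for simple closed triangular-lattice walks** (closed form of
`TriWalk.eight_mul_sum_W_notMem`; registered sub-goal `pickParity_eight_mul_sum_W_notMem` of
stmt-ValiantsHypothesis-5066, second milestone of stub `stub_pickParity`). [folklore] -/
theorem pickParity_eight_mul_sum_W_notMem : ∀ {ℓ : ℕ} (c : Summit.ValiantsHypothesis.ValiantsHypothesis.Theorems.DivisionGapZeroOneTransfer.TriWalk ℓ), (∀ i j, c.v i = c.v j → i % ℓ = j % ℓ) → 3 ≤ ℓ → ∀ {P₀ P₁ Q₀ Q₁ : ℤ}, (∀ j, P₀ ≤ (c.v j).1 ∧ (c.v j).1 ≤ P₁) → (∀ j, Q₀ ≤ (c.v j).2 ∧ (c.v j).2 ≤ Q₁) → 8 * ∑ u ∈ (Finset.Icc P₀ P₁ ×ˢ Finset.Icc Q₀ Q₁).filter (fun u => u ∉ (Finset.range ℓ).image c.v), c.W₁ u.1 u.2 = 4 * c.shoelace - ℓ * (8 * c.Wrf (c.v 0) (c.v 1) + 4) + ∑ j ∈ Finset.range ℓ, Summit.ValiantsHypothesis.ValiantsHypothesis.Theorems.DivisionGapZeroOneTransfer.turn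 (c.v (j + 1) - c.v j) (c.v (j + 2) - c.v (j + 1)) :=
  fun c hs hn _ _ _ _ hX hY => c.eight_mul_sum_W_notMem hs hn hX hY

end Summit.ValiantsHypothesis.ValiantsHypothesis.Theorems.DivisionGapZeroOneTransfer
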